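import Literature.RingTheory.CohomologyAnnihilator.Basic
import Mathlib.LinearAlgebra.FreeModule.PID
import Mathlib.Algebra.Module.Projective
import Mathlib.Algebra.Category.ModuleCat.Projective
import Mathlib.Algebra.Homology.DerivedCategory.Ext.EnoughProjectives
import HarnessLib

/-!
# Conductor elements into a PID annihilate `Ext²` (supporting lemma for `StubCaSheafFalse`)

Negative-lemma chain for crux `Globalisation` (stmt-ResolutionOfSingularities-16486, route
`HomologicalConductor`), file 1/6. If `j : T → T̄` is an injective ring map into a principal ideal
domain and `c ∈ T` is a CONDUCTOR element (`j(c)·T̄ ⊆ j(T)`), then `c ∈ ca²(T)`, i.e. `c` kills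
`Ext²_T(M, N)` for all finitely generated `M`, `N` (hence all `Extⁱ`, `i ≥ 2`, by
[IyengarTakahashi2014, Remark 2.3]). Proof: dimension shifting to `Ext¹(ΩM, N)` with `ΩM ≤ Tⁿ`;
`T̄·j(ΩM) ≤ T̄ⁿ` is free over the PID `T̄`, so the surjection from `T̄ᵐ` onto it given by generators
of `ΩM` has a `T̄`-linear section; multiplying the section by the conductor lands in `j(T)`, which
factors `c • 𝟙_{ΩM}` through the free module `Tᵐ`, on which `Ext¹` vanishes. (This reproves
"conductor ⊆ ca" for curves, classification-free.)
-/

set_option linter.dupNamespace false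

noncomputable section

namespace Summit.ResolutionOfSingularities.ResolutionOfSingularities.Theorems.Globalisation.Negative

open CategoryTheory CategoryTheory.Abelian Literature.RingTheory.CohomologyAnnihilator

universe u

namespace Conductor

variable {T : Type u} [CommRing T] {Tbar : Type u} [CommRing Tbar] [IsDomain Tbar]
  [IsPrincipalIdealRing Tbar]
  (j : T →+* Tbar) (hj : Function.Injective j) {c : T}
  (hc : ∀ b : Tbar, ∃ a : T, j a = j c * b)

include hj hc in
/-- Factorisation: for a finitely generated submodule `A ≤ Tⁿ`, multiplication by the conductor
element `c` on `A` factors `T`-linearly through a finite free module. [folklore] -/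
theorem exists_factor_of_conductor {n : ℕ} (A : Submodule T (Fin n → T)) (hA : A.FG) :
    ∃ (m : ℕ) (μ : A →ₗ[T] (Fin m → T)) (ν : (Fin m → T) →ₗ[T] A),
      ∀ a : A, ν (μ a) = c • a := by
  classical
  letI : Algebra T Tbar := j.toAlgebra
  have hsmul : ∀ (t : T) (b : Tbar), t • b = j t * b := fun t b => Algebra.smul_def t b
  -- the componentwise embedding `Tⁿ → T̄ⁿ`
  let jn : (Fin n → T) →ₗ[T] (Fin n → Tbar) := (Algebra.linearMap T Tbar).compLeft (Fin n)
  have jn_apply : ∀ (v : Fin n → T) (i : Fin n), jn v i = j (v i) := fun v i => rfl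
  have jn_inj : Function.Injective jn := by
    intro v w h
    funext i
    exact hj (by rw [← jn_apply, ← jn_apply, h])
  -- generators of `A`
  haveI : Module.Finite T A := Module.Finite.iff_fg.mpr hA
  obtain ⟨m, s, hs⟩ := Module.Finite.exists_fin (R := T) (M := A)
  -- `Ā = T̄ · j(A)`, generated by the images of the generators
  let g : Fin m → (Fin n → Tbar) := fun i => jn (A.subtype (s i))
  let Abar : Submodule Tbar (Fin n → Tbar) := Submodule.span Tbar (Set.range g)
  have mem_Abar : ∀ a : A, jn (A.subtype a) ∈ Abar := by
    intro a
    have ha : a ∈ Submodule.span T (Set.range s) := by rw [hs]; trivial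
    refine Submodule.span_induction (p := fun a _ => jn (A.subtype a) ∈ Abar) ?_ ?_ ?_ ?_ ha
    · rintro _ ⟨i, rfl⟩
      exact Submodule.subset_span ⟨i, rfl⟩
    · simp
    · intro x y _ _ hx hy
      simpa using Submodule.add_mem _ hx hy
    · intro t x _ hx
      have : jn (A.subtype (t • x)) = (j t) • jn (A.subtype x) := by
        rw [map_smul, map_smul]
        funext i
        simp [hsmul]
      rw [this]
      exact Submodule.smul_mem _ _ hx
  -- `Ā` is free (submodule of a free module over a PID), hence projective
  obtain ⟨r, bA⟩ := Submodule.basisOfPid (Pi.basisFun Tbar (Fin n)) Abar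
  haveI : Module.Free Tbar Abar := Module.Free.of_basis bA
  haveI : Module.Projective Tbar Abar := Module.Projective.of_free
  -- the surjection `T̄ᵐ → Ā` onto the generators, and a section of it
  let g' : Fin m → Abar := fun i => ⟨g i, Submodule.subset_span ⟨i, rfl⟩⟩
  let πbar : (Fin m → Tbar) →ₗ[Tbar] Abar := Fintype.linearCombination Tbar g'
  have hπbar : Function.Surjective πbar := by
    rw [← LinearMap.range_eq_top, Fintype.range_linearCombination]
    have : Set.range g' = ((↑) : Abar → (Fin n → Tbar)) ⁻¹' Set.range g := by
      ext x
      constructor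
      · rintro ⟨i, rfl⟩
        exact ⟨i, rfl⟩
      · rintro ⟨i, hi⟩
        exact ⟨i, Subtype.ext hi⟩
    rw [this]
    exact Submodule.span_span_coe_preimage
  obtain ⟨σ, hσ⟩ := Module.projective_lifting_property πbar LinearMap.id hπbar
  -- lifting `j c * b` back to `T`
  let lift : Tbar → T := fun b => Classical.choose (hc b)
  have hlift : ∀ b, j (lift b) = j c * b := fun b => Classical.choose_spec (hc b)
  -- `μ`
  let μf : A → (Fin m → T) := fun a => fun i => lift (σ ⟨jn (A.subtype a), mem_Abar a⟩ i)
  have hμf : ∀ (a : A) (i : Fin m), j (μf a i) = j c * σ ⟨jn (A.subtype a), mem_Abar a⟩ i :=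
    fun a i => hlift _
  let μ : A →ₗ[T] (Fin m → T) :=
    { toFun := μf
      map_add' := by
        intro a b
        funext i
        apply hj
        have hadd : (⟨jn (A.subtype (a + b)), mem_Abar (a + b)⟩ : Abar) =
            ⟨jn (A.subtype a), mem_Abar a⟩ + ⟨jn (A.subtype b), mem_Abar b⟩ :=
          Subtype.ext (by simp [map_add])
        rw [Pi.add_apply, map_add, hμf, hμf, hμf, ← mul_add, ← Pi.add_apply, ← map_add, hadd]
      map_smul' := by
        intro t a
        funext i
        apply hj
        rw [RingHom.id_apply, Pi.smul_apply, smul_eq_mul, map_mul, hμf, hμf, ← mul_assoc,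
          mul_comm (j t), mul_assoc]
        congr 1
        have : (⟨jn (A.subtype (t • a)), mem_Abar (t • a)⟩ : Abar) =
            (j t) • ⟨jn (A.subtype a), mem_Abar a⟩ := by
          apply Subtype.ext
          change jn (A.subtype (t • a)) = j t • jn (A.subtype a)
          rw [map_smul, map_smul]
          funext k
          simp [hsmul]
        rw [this, map_smul, Pi.smul_apply, smul_eq_mul] }
  -- `ν`
  let ν : (Fin m → T) →ₗ[T] A := Fintype.linearCombination T s
  refine ⟨m, μ, ν, fun a => ?_⟩
  -- check the identity after applying the injective map `jn ∘ A.subtype`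
  apply A.injective_subtype
  apply jn_inj
  have key : ∀ w : Fin m → T, jn (A.subtype (ν w)) = πbar (fun i => j (w i)) := by
    intro w
    simp only [ν, πbar, Fintype.linearCombination_apply, map_sum, map_smul]
    rw [Submodule.coe_sum]
    refine Finset.sum_congr rfl fun i _ => ?_
    rw [Submodule.coe_smul]
    change j (w i) • jn (A.subtype (s i)) = j (w i) • g i
    rfl
  rw [key]
  have hw : (fun i => j (μ a i)) = j c • σ ⟨jn (A.subtype a), mem_Abar a⟩ := by
    funext i
    exact hμf a i
  rw [hw, map_smul]
  have hsec : πbar (σ ⟨jn (A.subtype a), mem_Abar a⟩) = ⟨jn (A.subtype a), mem_Abar a⟩ :=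
    LinearMap.congr_fun hσ _
  rw [hsec, Submodule.coe_smul, map_smul, map_smul]
  change j c • jn (A.subtype a) = c • jn (A.subtype a)
  funext i
  simp [hsmul]

include hj hc in
/-- A conductor element `c` (with `j(c)·T̄ ⊆ j(T)` for an injective `j : T → T̄` into a PID)
annihilates `Ext²_T(M, N)` for all finitely generated `M`, `N`, i.e. `c ∈ ca²(T)`: by dimension
shifting `Ext¹(ΩM, N) ↠ Ext²(M, N)`, and on the torsion-free syzygy `ΩM ≤ Tⁿ` multiplication by
`c` factors through a finite free module, on which `Ext¹` vanishes. [folklore] -/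
theorem mem_cohomologyAnnihilatorOfDegree_two_of_conductor [IsNoetherianRing T] [Small.{u} T] :
    c ∈ cohomologyAnnihilatorOfDegree T 2 := by
  rw [mem_cohomologyAnnihilatorOfDegree_iff_of_isNoetherianRing]
  intro M N hM hN e
  obtain ⟨n, s, hs⟩ := Module.Finite.exists_fin (R := T) (M := M)
  let π : (Fin n → T) →ₗ[T] M := Fintype.linearCombination T s
  have hπ : Function.Surjective π := by
    rw [← LinearMap.range_eq_top, Fintype.range_linearCombination, hs]
  have hS := LinearMap.shortExact_shortComplexKer hπ
  obtain ⟨e', rfl⟩ := precomp_extClass_surjective_of_projective_X₂ N hS 1 e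
  suffices h : c • e' = 0 by
    change c • (hS.extClass.precompOfLinear T N (add_comm 1 1)) e' = 0
    rw [← LinearMap.map_smul, h, LinearMap.map_zero]
  have hA : (LinearMap.ker π).FG := IsNoetherian.noetherian _
  obtain ⟨m, μ, ν, hμν⟩ := exists_factor_of_conductor j hj hc (LinearMap.ker π) hA
  have h1 : c • e' = (Ext.mk₀ (c • 𝟙 (π.shortComplexKer).X₁)).comp e' (zero_add 1) := by
    rw [Ext.mk₀_smul, Ext.smul_comp, Ext.mk₀_id_comp]
  have h2 : (c • 𝟙 (π.shortComplexKer).X₁ : (π.shortComplexKer).X₁ ⟶ (π.shortComplexKer).X₁) =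
      ModuleCat.ofHom μ ≫ ModuleCat.ofHom (Y := (π.shortComplexKer).X₁) ν := by
    apply ModuleCat.hom_ext
    apply LinearMap.ext
    intro a
    change c • a = ν (μ a)
    rw [hμν]
  rw [h1, h2, ← Ext.mk₀_comp_mk₀_assoc, Ext.eq_zero_of_projective ((Ext.mk₀ _).comp e' _),
    Ext.comp_zero]

end Conductor

end Summit.ResolutionOfSingularities.ResolutionOfSingularities.Theorems.Globalisation.Negative

end
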